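import Literature.MathematicalPhysics.QuantumFieldTheory.QCD
import Literature.MathematicalPhysics.QuantumLattice.GrassmannIntegral
import Literature.MathematicalPhysics.QuantumLattice.GaugeGroups

/-!
# Prep for stub `stub_nikolskii` of crux `FibreCofactorDomination` (stmt-QuantumFields-11510)

Line `Sketch-ideator3` (card A `random-refit-second-moment`), route PauliWegnerSea (sub QCD).
Ingredients of the two-star Nikolskii inequality that do not need the abstract (finite-family)
Nikolskii inequality of `Literature.Analysis.Approximation.FiniteFamilyNikolskii`:

1. `prod_mem_pow`, `span_pow_le_span_prod`: bookkeeping for submodule powers of a span in a function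
   algebra (products of `n` generators span `(span S) ^ n`).
2. `ofReal_sum_sq_le`: summing one-point inequalities `‖F k ω‖² ≤ C ∫ ‖F k‖²` over a finite family
   (`lintegral` form).
3. `pi_nikolskii`: **product Nikolskii by peeling one coordinate at a time** — if
   `Φ : (ι → G) → ℝ≥0∞` satisfies `Φ W ≤ C ∫ Φ(W[e ↦ g]) dν(g)` for the coordinates `e ∈ S` and does
   not depend on the coordinates `e ∉ S`, then `Φ W₀ ≤ C ^ #S ∫ Φ d(ν^⊗ι)` (iterated `lmarginal`s).
4. `wilsonDirac_update_entry_mem`, `adjugate_wilsonDirac_update_mem`: **one-link polynomial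
   structure** — as a function of one link `g = V(e) ∈ SU(3)`, every entry of `D_W(V[e ↦ g])` is
   affine in `g_{ab}`, `conj g_{ab}` and non-constant only in the `≤ 24` rows at the endpoints of `e`
   (`sum_rowWeight_le`), so by Leibniz every cofactor lies in `P ^ n` (`n ≥ 24`) for any submodule
   `P ∋ 1, g_{ab}, conj g_{ab}` of the function algebra `SU(3) → ℂ`.
5. `card_twoStar_le` (two stars have `≤ 16` links) and the refit-vs-update identities
   `refit_update_of_mem`, `refit_update_of_not_mem`, `continuous_refit`.
-/

noncomputable section

namespace Summit.QuantumFields.QCD.Theorems.RandomRefit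

open scoped BigOperators Matrix
open MeasureTheory Filter Literature.MathematicalPhysics.QuantumFieldTheory
  Literature.MathematicalPhysics.QuantumLattice Literature.Probability.LatticeModels

/-! ### Submodule powers of a span in a function algebra -/

/-- In a commutative algebra, a product of elements `f i ∈ M ^ (d i)` lies in `M ^ (Σ d i)`. -/
theorem prod_mem_pow {R A : Type*} [CommSemiring R] [CommSemiring A] [Algebra R A]
    (M : Submodule R A) {κ : Type*} (s : Finset κ) (f : κ → A) (d : κ → ℕ)
    (h : ∀ i ∈ s, f i ∈ M ^ d i) : ∏ i ∈ s, f i ∈ M ^ ∑ i ∈ s, d i := by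
  classical
  induction s using Finset.induction_on with
  | empty =>
    rw [Finset.prod_empty, Finset.sum_empty, pow_zero]
    exact Submodule.one_le.mp le_rfl
  | insert a s ha ih =>
    rw [Finset.prod_insert ha, Finset.sum_insert ha, pow_add]
    exact Submodule.mul_mem_mul (h a (Finset.mem_insert_self a s))
      (ih fun i hi => h i (Finset.mem_insert_of_mem hi))

/-- The `n`-fold submodule power of the span of a family `gen` is contained in the span of the
`n`-fold products `∏ i : Fin n, gen (t i)`. -/
theorem span_pow_le_span_prod {Ω J : Type*} (gen : J → Ω → ℂ) (n : ℕ) :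
    Submodule.span ℂ (Set.range gen) ^ n ≤
      Submodule.span ℂ (Set.range fun t : Fin n → J => ∏ i, gen (t i)) := by
  rw [Submodule.span_pow]
  refine Submodule.span_mono ?_
  rintro f hf
  obtain ⟨t, ht⟩ := Set.mem_pow.mp hf
  rw [List.prod_ofFn] at ht
  choose j hj using fun i => (t i).2
  exact ⟨j, by rw [← ht]; exact Finset.prod_congr rfl fun i _ => hj i⟩

/-! ### Summing one-point inequalities over a finite family -/

/-- Summing one-point Nikolskii inequalities over a finite family: if each `F k` is continuous and
satisfies `‖F k ω‖² ≤ C ∫ ‖F k‖² dμ` (`lintegral` form), then `Σ_k ‖F k ω‖² ≤ C ∫ Σ_k ‖F k‖² dμ`. -/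
theorem ofReal_sum_sq_le {Ω K : Type*} [TopologicalSpace Ω] [MeasurableSpace Ω]
    [OpensMeasurableSpace Ω] [Fintype K] (μ : Measure Ω) (C : ENNReal) (F : K → Ω → ℂ)
    (hF : ∀ k, Continuous (F k) ∧
      ∀ ω, ENNReal.ofReal (‖F k ω‖ ^ 2) ≤ C * ∫⁻ ω', ENNReal.ofReal (‖F k ω'‖ ^ 2) ∂μ) (ω : Ω) :
    ENNReal.ofReal (∑ k, ‖F k ω‖ ^ 2) ≤ C * ∫⁻ ω', ENNReal.ofReal (∑ k, ‖F k ω'‖ ^ 2) ∂μ := by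
  have hm : ∀ k, Measurable fun ω' => ENNReal.ofReal (‖F k ω'‖ ^ 2) := fun k =>
    ((hF k).1.norm.pow 2).measurable.ennreal_ofReal
  rw [ENNReal.ofReal_sum_of_nonneg fun _ _ => by positivity]
  calc ∑ k, ENNReal.ofReal (‖F k ω‖ ^ 2)
      ≤ ∑ k, C * ∫⁻ ω', ENNReal.ofReal (‖F k ω'‖ ^ 2) ∂μ := Finset.sum_le_sum fun k _ => (hF k).2 ω
    _ = C * ∫⁻ ω', ∑ k, ENNReal.ofReal (‖F k ω'‖ ^ 2) ∂μ := by
        rw [← Finset.mul_sum, lintegral_finsetSum _ fun k _ => hm k]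
    _ = C * ∫⁻ ω', ENNReal.ofReal (∑ k, ‖F k ω'‖ ^ 2) ∂μ := by
        congr 1
        refine lintegral_congr fun ω' => ?_
        rw [ENNReal.ofReal_sum_of_nonneg fun _ _ => by positivity]

/-! ### Peeling one coordinate at a time -/

/-- Constants (`≠ ⊤`) come out of an iterated marginal `∫⋯∫⁻_s`. -/
theorem lmarginal_const_mul {δ : Type*} {X : δ → Type*} [∀ i, MeasurableSpace (X i)]
    [DecidableEq δ] (ν : ∀ i, Measure (X i)) (s : Finset δ) (C : ENNReal) (hC : C ≠ ⊤)
    (f : (∀ i, X i) → ENNReal) (x : ∀ i, X i) :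
    (∫⋯∫⁻_s, (fun y => C * f y) ∂ν) x = C * (∫⋯∫⁻_s, f ∂ν) x := by
  simp only [lmarginal]
  exact lintegral_const_mul' _ _ hC

/-- **Product Nikolskii inequality by peeling coordinates.**  Let `ν` be a probability measure on `G`,
`Φ : (ι → G) → ℝ≥0∞` measurable, `S` a finite set of coordinates and `C < ∞`.  If for every
`e ∈ S` and every `W` the one-coordinate inequality `Φ W ≤ C ∫ Φ (W[e ↦ g]) dν(g)` holds, and `Φ`
does not depend on the coordinates outside `S`, then `Φ W₀ ≤ C ^ #S · ∫ Φ d(⊗_ι ν)` for every `W₀`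
(induction over the coordinates with `lmarginal_insert'`). -/
theorem pi_nikolskii {ι G : Type*} [Fintype ι] [DecidableEq ι] [MeasurableSpace G]
    (ν : Measure G) [IsProbabilityMeasure ν] (Φ : (ι → G) → ENNReal) (hΦ : Measurable Φ)
    (S : Finset ι) (C : ENNReal) (hC : C ≠ ⊤)
    (hS : ∀ e ∈ S, ∀ W, Φ W ≤ C * ∫⁻ g, Φ (Function.update W e g) ∂ν)
    (hnS : ∀ e ∉ S, ∀ W g, Φ (Function.update W e g) = Φ W) (W₀ : ι → G) :
    Φ W₀ ≤ C ^ S.card * ∫⁻ W, Φ W ∂(Measure.pi fun _ : ι => ν) := by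
  -- one-coordinate step, for every coordinate, with constant `C_e ∈ {C, 1}`
  have step : ∀ (e : ι) (W : ι → G), Φ W ≤
      (if e ∈ S then C else 1) * ∫⁻ g, Φ (Function.update W e g) ∂ν := by
    intro e W
    by_cases he : e ∈ S
    · rw [if_pos he]; exact hS e he W
    · rw [if_neg he, one_mul]
      simp only [hnS e he, lintegral_const, measure_univ, mul_one, le_refl]
  suffices H : ∀ (s : Finset ι) (W : ι → G),
      Φ W ≤ C ^ (s ∩ S).card * (∫⋯∫⁻_s, Φ ∂fun _ : ι => ν) W by
    simpa only [lmarginal_univ, Finset.univ_inter] using H Finset.univ W₀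
  intro s
  induction s using Finset.induction_on with
  | empty => intro W; simp [lmarginal_empty]
  | insert e s hes ih =>
    intro W
    have hCe : (if e ∈ S then C else (1 : ENNReal)) ≠ ⊤ := by split_ifs <;> simp [hC]
    have hmono : (∫⋯∫⁻_s, Φ ∂fun _ : ι => ν) W ≤
        (if e ∈ S then C else 1) * (∫⋯∫⁻_(insert e s), Φ ∂fun _ : ι => ν) W := by
      rw [lmarginal_insert' _ hΦ hes, ← lmarginal_const_mul _ s _ hCe]
      exact lmarginal_mono (fun W' => step e W') W
    have hcard : C ^ (s ∩ S).card * (if e ∈ S then C else 1) = C ^ ((insert e s) ∩ S).card := by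
      by_cases he : e ∈ S
      · rw [if_pos he, Finset.insert_inter_of_mem he, Finset.card_insert_of_notMem
          (fun h => hes (Finset.mem_inter.mp h).1), pow_succ]
      · rw [if_neg he, Finset.insert_inter_of_notMem he, mul_one]
    calc Φ W ≤ C ^ (s ∩ S).card * (∫⋯∫⁻_s, Φ ∂fun _ : ι => ν) W := ih W
      _ ≤ C ^ (s ∩ S).card * ((if e ∈ S then C else 1) *
            (∫⋯∫⁻_(insert e s), Φ ∂fun _ : ι => ν) W) := by gcongr
      _ = C ^ ((insert e s) ∩ S).card * (∫⋯∫⁻_(insert e s), Φ ∂fun _ : ι => ν) W := by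
            rw [← mul_assoc, hcard]

variable {L : ℕ}

/-! ### Counting: rows at two sites, links of two stars -/

/-- At most `24` colour–spin row indices live at two given sites. -/
theorem sum_rowWeight_le [NeZero L] (z z' : TorusSite 4 L) :
    ∑ r : TorusSite 4 L × Fin 3 × Fin 4, (if r.1 = z ∨ r.1 = z' then 1 else 0) ≤ 24 := by
  classical
  rw [Finset.sum_boole, Nat.cast_id]
  calc (Finset.univ.filter fun r : TorusSite 4 L × Fin 3 × Fin 4 => r.1 = z ∨ r.1 = z').card
      ≤ (({z, z'} : Finset (TorusSite 4 L)) ×ˢ (Finset.univ : Finset (Fin 3 × Fin 4))).card := by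
        refine Finset.card_le_card fun r hr => ?_
        simp only [Finset.mem_filter, Finset.mem_univ, true_and] at hr
        simp only [Finset.mem_product, Finset.mem_insert, Finset.mem_singleton, Finset.mem_univ,
          and_true]
        exact hr
    _ ≤ 2 * 12 := by
        rw [Finset.card_product]
        exact Nat.mul_le_mul Finset.card_le_two (by simp)

/-- The two stars `star(x) ∪ star(y)` consist of at most `16` links. -/
theorem card_twoStar_le [NeZero L] (x y : TorusSite 4 L) :
    (Finset.univ.filter fun e : Edge 4 L =>
      e.1 = x ∨ e.1.shift e.2 = x ∨ e.1 = y ∨ e.1.shift e.2 = y).card ≤ 16 := by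
  classical
  set out : TorusSite 4 L → Finset (Edge 4 L) := fun z => Finset.univ.image fun μ : Fin 4 => (z, μ)
  set inc : TorusSite 4 L → Finset (Edge 4 L) := fun z =>
    Finset.univ.image fun μ : Fin 4 => (z - Pi.single μ 1, μ)
  have hout : ∀ z, (out z).card ≤ 4 := fun z => Finset.card_image_le.trans (by simp)
  have hinc : ∀ z, (inc z).card ≤ 4 := fun z => Finset.card_image_le.trans (by simp)
  have key : ∀ (e : Edge 4 L) (z : TorusSite 4 L),
      (e.1 = z → e ∈ out z) ∧ (e.1.shift e.2 = z → e ∈ inc z) := fun e z =>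
    ⟨fun h => Finset.mem_image.mpr ⟨e.2, Finset.mem_univ _, by rw [← h]⟩,
     fun h => Finset.mem_image.mpr ⟨e.2, Finset.mem_univ _, by
        rw [← h]
        exact Prod.ext (by simp [Literature.MathematicalPhysics.QuantumFieldTheory.Site.shift]) rfl⟩⟩
  have hsub : (Finset.univ.filter fun e : Edge 4 L =>
      e.1 = x ∨ e.1.shift e.2 = x ∨ e.1 = y ∨ e.1.shift e.2 = y) ⊆
      (out x ∪ inc x) ∪ (out y ∪ inc y) := by
    intro e he
    simp only [Finset.mem_filter, Finset.mem_univ, true_and] at he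
    simp only [Finset.mem_union]
    rcases he with h | h | h | h
    · exact Or.inl (Or.inl ((key e x).1 h))
    · exact Or.inl (Or.inr ((key e x).2 h))
    · exact Or.inr (Or.inl ((key e y).1 h))
    · exact Or.inr (Or.inr ((key e y).2 h))
  calc _ ≤ ((out x ∪ inc x) ∪ (out y ∪ inc y)).card := Finset.card_le_card hsub
    _ ≤ ((out x).card + (inc x).card) + ((out y).card + (inc y).card) :=
        (Finset.card_union_le _ _).trans
          (add_le_add (Finset.card_union_le _ _) (Finset.card_union_le _ _))
    _ ≤ (4 + 4) + (4 + 4) :=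
        add_le_add (add_le_add (hout x) (hinc x)) (add_le_add (hout y) (hinc y))

/-! ### One-link polynomial structure of the Wilson–Dirac matrix and of its cofactors -/

/-- Each entry of `D_W(V[e ↦ g])`, as a function of the link variable `g ∈ SU(3)`, lies in any submodule
`P` of functions containing the constants, the coordinates `g ↦ g_{ab}` and their conjugates; the
entries in rows away from the two endpoints `e.1`, `e.1 + ê.2` of `e` are constant (lie in `P ^ 0`). -/
theorem wilsonDirac_update_entry_mem [NeZero L] (P : Submodule ℂ (SU3 → ℂ)) (h1 : (1 : SU3 → ℂ) ∈ P)
    (hc : ∀ a b : Fin 3, (fun g : SU3 => (g : Matrix (Fin 3) (Fin 3) ℂ) a b) ∈ P)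
    (hs : ∀ a b : Fin 3, (fun g : SU3 => star ((g : Matrix (Fin 3) (Fin 3) ℂ) a b)) ∈ P)
    (V : GaugeConfig 4 L SU3) (e : Edge 4 L) (m₀ r₀ : ℝ) (r c : TorusSite 4 L × Fin 3 × Fin 4) :
    (fun g => wilsonDirac (fundamentalRep (Fin 3)) (Function.update V e g) m₀ r₀ r c) ∈
      P ^ (if r.1 = e.1 ∨ r.1 = e.1.shift e.2 then 1 else 0) := by
  have h1d : ∀ d : ℕ, d ≤ 1 → (1 : SU3 → ℂ) ∈ P ^ d := by
    intro d hd
    interval_cases d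
    · exact Submodule.one_le.mp le_rfl
    · rwa [pow_one]
  set d : ℕ := if r.1 = e.1 ∨ r.1 = e.1.shift e.2 then 1 else 0 with hd_def
  have hd : d ≤ 1 := by rw [hd_def]; split_ifs <;> simp
  have hconst : ∀ κ : ℂ, (fun _ : SU3 => κ) ∈ P ^ d := fun κ => by
    have : (fun _ : SU3 => κ) = κ • (1 : SU3 → ℂ) := by ext g; simp
    rw [this]; exact Submodule.smul_mem _ κ (h1d d hd)
  -- forward links `ρ(V'(r.1, μ))_{ab}`, `V' = V[e ↦ g]`
  have hF : ∀ (μ : Fin 4) (a b : Fin 3),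
      (fun g : SU3 => fundamentalRep (Fin 3) (Function.update V e g (r.1, μ)) a b) ∈ P ^ d := by
    intro μ a b
    by_cases h : (r.1, μ) = e
    · have hd1 : d = 1 := by rw [hd_def, if_pos (Or.inl (by rw [← h]))]
      rw [hd1, pow_one]
      convert hc a b using 2 with g
      rw [← h, Function.update_self, fundamentalRep_apply]
    · simp only [Function.update_of_ne h]
      exact hconst _
  -- backward links `ρ(V'(c.1, μ)⁻¹)_{ab}` in the rows `r.1 = c.1 + μ̂`
  have hB : ∀ μ : Fin 4, r.1 = Literature.MathematicalPhysics.QuantumFieldTheory.Site.shift c.1 μ → ∀ a b : Fin 3,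
      (fun g : SU3 => fundamentalRep (Fin 3) (Function.update V e g (c.1, μ))⁻¹ a b) ∈ P ^ d := by
    intro μ hμ a b
    by_cases h : (c.1, μ) = e
    · have hd1 : d = 1 := by
        rw [hd_def, if_pos (Or.inr ?_)]
        rw [← h]; exact hμ
      rw [hd1, pow_one]
      convert hs b a using 2 with g
      rw [← h, Function.update_self, ← Matrix.star_eq_inv, fundamentalRep_apply,
        Matrix.specialUnitaryGroup.coe_star, Matrix.star_apply]
    · simp only [Function.update_of_ne h]
      exact hconst _
  -- the entry, written in the function algebra
  have key : (fun g => wilsonDirac (fundamentalRep (Fin 3)) (Function.update V e g) m₀ r₀ r c) =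
      (fun _ => (if r = c then ((m₀ + 4 * r₀ : ℝ) : ℂ) else 0)) -
        (1 / 2 : ℂ) • ∑ μ : Fin 4,
          ((if c.1 = Literature.MathematicalPhysics.QuantumFieldTheory.Site.shift r.1 μ then
              (((r₀ : ℂ) • (1 : Matrix (Fin 4) (Fin 4) ℂ) - euclideanGamma μ) r.2.2 c.2.2) •
                (fun g : SU3 => fundamentalRep (Fin 3) (Function.update V e g (r.1, μ)) r.2.1 c.2.1)
            else 0) +
           (if r.1 = Literature.MathematicalPhysics.QuantumFieldTheory.Site.shift c.1 μ then
              (((r₀ : ℂ) • (1 : Matrix (Fin 4) (Fin 4) ℂ) + euclideanGamma μ) r.2.2 c.2.2) •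
                (fun g : SU3 => fundamentalRep (Fin 3) (Function.update V e g (c.1, μ))⁻¹ r.2.1 c.2.1)
            else 0)) := by
    funext g
    simp only [wilsonDirac, Matrix.of_apply, Pi.sub_apply, Pi.smul_apply, Finset.sum_apply,
      Pi.add_apply, smul_eq_mul]
    congr 1
    congr 1
    refine Finset.sum_congr rfl fun μ _ => ?_
    congr 1 <;> split_ifs <;> simp
  rw [key]
  refine Submodule.sub_mem _ (hconst _) (Submodule.smul_mem _ _
    (Submodule.sum_mem _ fun μ _ => Submodule.add_mem _ ?_ ?_))
  · split_ifs with h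
    · exact Submodule.smul_mem _ _ (hF μ _ _)
    · exact Submodule.zero_mem _
  · split_ifs with h
    · exact Submodule.smul_mem _ _ (hB μ h _ _)
    · exact Submodule.zero_mem _

/-- **One-link polynomial structure of the cofactors.**  As a function of one link variable
`g = V(e) ∈ SU(3)` (all other links frozen), every entry of `adj D_W(V[e ↦ g])` lies in `P ^ n`,
`n ≥ 24`: a cofactor is a signed maximal minor (Leibniz), multilinear in the rows, and `g`, `ḡ` enter
only the `≤ 24` rows at the two endpoints of `e`, affinely. -/
theorem adjugate_wilsonDirac_update_mem [NeZero L] (P : Submodule ℂ (SU3 → ℂ))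
    (h1 : (1 : SU3 → ℂ) ∈ P)
    (hc : ∀ a b : Fin 3, (fun g : SU3 => (g : Matrix (Fin 3) (Fin 3) ℂ) a b) ∈ P)
    (hs : ∀ a b : Fin 3, (fun g : SU3 => star ((g : Matrix (Fin 3) (Fin 3) ℂ) a b)) ∈ P)
    (V : GaugeConfig 4 L SU3) (e : Edge 4 L) (m₀ r₀ : ℝ) (p q : TorusSite 4 L × Fin 3 × Fin 4)
    (n : ℕ) (hn : 24 ≤ n) :
    (fun g => (wilsonDirac (fundamentalRep (Fin 3)) (Function.update V e g) m₀ r₀).adjugate p q) ∈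
      P ^ n := by
  classical
  set M : Matrix (TorusSite 4 L × Fin 3 × Fin 4) (TorusSite 4 L × Fin 3 × Fin 4) (SU3 → ℂ) :=
    fun r c g => wilsonDirac (fundamentalRep (Fin 3)) (Function.update V e g) m₀ r₀ r c with hM
  have hfun : (fun g => (wilsonDirac (fundamentalRep (Fin 3)) (Function.update V e g) m₀ r₀).adjugate
      p q) = M.adjugate p q := by
    funext g
    have h := RingHom.map_adjugate (Pi.evalRingHom (fun _ : SU3 => ℂ) g) M
    have hMg : (Pi.evalRingHom (fun _ : SU3 => ℂ) g).mapMatrix M =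
        wilsonDirac (fundamentalRep (Fin 3)) (Function.update V e g) m₀ r₀ := by
      ext r c; rfl
    rw [hMg] at h
    rw [← h]
    rfl
  rw [hfun, Matrix.adjugate_apply, Matrix.det_apply]
  refine Submodule.sum_mem _ fun σ _ => ?_
  rw [Units.smul_def]
  refine zsmul_mem ?_ _
  set d : TorusSite 4 L × Fin 3 × Fin 4 → ℕ := fun r =>
    if r.1 = e.1 ∨ r.1 = e.1.shift e.2 then 1 else 0 with hd
  have hentry : ∀ r c, (M.updateRow q (Pi.single p 1)) r c ∈ P ^ d r := by
    intro r c
    rw [Matrix.updateRow_apply]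
    split_ifs with hrq
    · rw [Pi.single_apply]
      split_ifs
      · have hdr : d r ≤ 1 := by simp only [hd]; split_ifs <;> simp
        rcases Nat.le_one_iff_eq_zero_or_eq_one.mp hdr with h0 | h0 <;> rw [h0]
        · exact Submodule.one_le.mp le_rfl
        · rwa [pow_one]
      · exact Submodule.zero_mem _
    · exact wilsonDirac_update_entry_mem P h1 hc hs V e m₀ r₀ r c
  have hprod := prod_mem_pow P Finset.univ (fun i => (M.updateRow q (Pi.single p 1)) (σ i) i)
    (fun i => d (σ i)) fun i _ => hentry (σ i) i
  have hsum : ∑ i, d (σ i) = ∑ r, d r := Equiv.sum_comp σ d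
  have hle : ∑ r, d r ≤ 24 := sum_rowWeight_le e.1 (e.1.shift e.2)
  exact pow_le_pow_right₀ (Submodule.one_le.mpr h1) ((hsum.trans_le hle).trans hn) hprod

/-- **Registered sub-goal `stub_nikolskii_oneLink` (one-link polynomial structure of the Wilson–Dirac
cofactors)**: `adjugate_wilsonDirac_update_mem` as a closed statement — for every submodule `P` of
functions on `SU(3)` containing `1`, `g ↦ g_{ab}` and `g ↦ conj g_{ab}`, every cofactor of
`D_W(V[e ↦ g])` lies, as a function of the link `g`, in `P ^ n` for `n ≥ 24`. -/
theorem stub_nikolskii_oneLink :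
    ∀ (L : ℕ) [NeZero L] (P : Submodule ℂ (Matrix.specialUnitaryGroup (Fin 3) ℂ → ℂ)), (1 :
    Matrix.specialUnitaryGroup (Fin 3) ℂ → ℂ) ∈ P → (∀ a b : Fin 3, (fun g :
    Matrix.specialUnitaryGroup (Fin 3) ℂ => (g : Matrix (Fin 3) (Fin 3) ℂ) a b) ∈ P) → (∀ a b : Fin
    3, (fun g : Matrix.specialUnitaryGroup (Fin 3) ℂ => star ((g : Matrix (Fin 3) (Fin 3) ℂ) a b)) ∈
    P) → ∀ (V : GaugeConfig 4 L (Matrix.specialUnitaryGroup (Fin 3) ℂ)) (e : Edge 4 L) (m₀ r₀ : ℝ)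
    (p q : TorusSite 4 L × Fin 3 × Fin 4) (n : ℕ), 24 ≤ n → (fun g : Matrix.specialUnitaryGroup (Fin
    3) ℂ => (wilsonDirac (fundamentalRep (Fin 3)) (Function.update V e g) m₀ r₀).adjugate p q) ∈ P ^
    n :=
  fun _ _ P h1 hc hs V e m₀ r₀ p q n hn => adjugate_wilsonDirac_update_mem P h1 hc hs V e m₀ r₀ p q n hn

/-! ### The refit along a set of links -/

/-- Refitting a configuration updated at a star link = updating the refit. -/
theorem refit_update_of_mem {G' : Type*} (st : Edge 4 L → Prop) [DecidablePred st]
    (U W : Edge 4 L → G') (e : Edge 4 L) (g : G') (he : st e) :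
    (fun e' => if st e' then Function.update W e g e' else U e') =
      Function.update (fun e' => if st e' then W e' else U e') e g := by
  funext e'
  by_cases h : e' = e
  · subst h; simp [he]
  · rw [Function.update_of_ne h, Function.update_of_ne h]

/-- The refit does not read the links off the stars. -/
theorem refit_update_of_not_mem {G' : Type*} (st : Edge 4 L → Prop) [DecidablePred st]
    (U W : Edge 4 L → G') (e : Edge 4 L) (g : G') (he : ¬st e) :
    (fun e' => if st e' then Function.update W e g e' else U e') =
      fun e' => if st e' then W e' else U e' := by
  funext e'
  by_cases h' : st e'
  · have hne : e' ≠ e := fun hh => he (hh ▸ h')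
    simp [h', Function.update_of_ne hne]
  · simp [h']

/-- The refit is continuous in the fibre variable. -/
theorem continuous_refit {G' : Type*} [TopologicalSpace G'] (st : Edge 4 L → Prop) [DecidablePred st]
    (U : Edge 4 L → G') : Continuous fun (W : Edge 4 L → G') (e' : Edge 4 L) =>
      if st e' then W e' else U e' := by
  refine continuous_pi fun e' => ?_
  by_cases h : st e'
  · simp only [h, if_true]; exact continuous_apply e'
  · simp only [h, if_false]; exact continuous_const

end Summit.QuantumFields.QCD.Theorems.RandomRefit

end
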